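import Mathlib
import Summits.MatrixMultiplication.Statement
import Summits.MatrixMultiplication.MatrixMultiplication.Theorems.GraphEquationsDeepLowestForms

/-!
# The MASKING witness: a correct family of tests that is lowest-form degenerate at EVERY base point,
# unmasked by one elimination step (`GraphEquations`, M31)

Decomp-mm node «GraphEquations» (lens 5, g36); attacked leaf `MultiplicityReduction`
(stmt-MatrixMultiplication-27806).  Target VERBATIM: `_root_.MatrixMultiplication`.  Route-neutral.
Kernels M28–M30 showed that in border rank the ORDER of the lowest weighted forms is free
(`LowInitNondegAt`: pure lowest forms of arbitrary orders with a nondegenerate gradient matrix ⇒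
`bR(⟨n,n,n⟩) ≤ 2·cost`; stable under squaring).  What `LowInitNondegAt` does NOT survive is MASKING:
a lowest form that involves `a, b`.  This module makes the residual a LEMMA BY EXAMPLE (`n = 2`):

  `maskedFamily = (f₀₀, f₀₁, f₁₀, t)`,  `t = f₁₁² − a₀₀·f₀₀`  (`maskedTest`).

* `maskedFamily_vanish_iff` — its common zero set is exactly the graph `W_2` (so any fan-in-two
  system with these tests is correct; `zeroSet_eq_of_tests_eq_maskedFamily`);
* `maskedFamily_pderiv_eq_zero` — at EVERY base point `x ∈ ℂ^{12}` (on or off the graph), every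
  admissible choice of orders `m_o` and pure lowest forms `P_o` has `∂P_o/∂F₁₁ = 0` for all `o`:
  the weight-`3` form `−a₀₀ F₀₀` of `t` is impure, the weight-`2` form `−x(a₀₀) F₀₀` it acquires at
  `x(a₀₀) ≠ 0` is a multiple of the form of `f₀₀`, and pure forms have no odd-weight components
  (`weightedHomogeneousComponent_odd_aeval_generator`);
* `maskedFamily_gradMatrix_rank_le` — hence the gradient matrix has rank `≤ 3 < 4 = n²` for every
  such choice: NO system with these four tests is `LowInitNondegAt x`, at any `x`
  (`not_lowInitNondegAt_of_tests_eq_maskedFamily`) — although the family is correct and cheap;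
* `maskedTest_add_unmask` — ONE elimination step `t + a₀₀·t₀ = f₁₁²` (one product, one sum)
  unmasks it into the pure-power family `(f₀₀, f₀₁, f₁₀, f₁₁²)`, served at `2N` by M26/M28.

Reading: `MultiplicityReduction ⟺ LowestFormReduction` (M29) asks for the COST OF UNMASKING along
cheap correct families (the order being free, M30).  No `sorry`.
Sources: [BurgisserClausenShokrollahi1997, Problem 16.3]; [Strassen1973]; T. Mora, EUROCAM 1982.
-/

set_option linter.dupNamespace false

noncomputable section

open scoped BigOperators

namespace Summit.MatrixMultiplication.MatrixMultiplication.Theorems.GraphEquations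

open MvPolynomial
open Literature.Computability.AlgebraicComplexity
open Literature.Computability.AlgebraicComplexity.ArithCircuit

variable {n : ℕ}

/-! ## Pure forms have no odd-weight components -/

/-- `P(f)` has no component of odd weight. -/
theorem weightedHomogeneousComponent_odd_aeval_generator (P : MvPolynomial (Fin n × Fin n) ℂ) (d : ℕ) :
    weightedHomogeneousComponent (gw n) (2 * d + 1) (aeval (generator n) P) = 0 := by
  classical
  conv_lhs => rw [← sum_homogeneousComponent P]
  rw [map_sum, map_sum]
  refine Finset.sum_eq_zero fun i _ => ?_
  rw [weightedHomogeneousComponent_of_mem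
    (isWeightedHomogeneous_aeval_generator (homogeneousComponent_isHomogeneous i P)), if_neg (by omega)]

/-- A pure polynomial equal to an odd-weight form vanishes, and so does the form. -/
theorem eq_zero_of_isWeightedHomogeneous_odd_eq_aeval {A : MvPolynomial (GraphVars n) ℂ} {d : ℕ}
    (hA : IsWeightedHomogeneous (gw n) A (2 * d + 1)) {P : MvPolynomial (Fin n × Fin n) ℂ}
    (h : A = aeval (generator n) P) : A = 0 := by
  classical
  have h1 : weightedHomogeneousComponent (gw n) (2 * d + 1) A = A := by
    rw [weightedHomogeneousComponent_of_mem hA, if_pos rfl]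
  rw [← h1, h, weightedHomogeneousComponent_odd_aeval_generator]

/-- The generator does not vanish identically (value `1` at `c_q = 1`, `a = b = 0`). -/
theorem generator_ne_zero (q : Fin n × Fin n) : generator n q ≠ 0 := by
  intro h
  have h1 : eval (fun v : GraphVars n => if v = Sum.inr q then (1 : ℂ) else 0) (generator n q) = 1 := by
    simp [generator]
  rw [h, map_zero] at h1
  exact zero_ne_one h1

/-- Lowest-form analysis of a SHIFTED GENERATOR `f_q + κ`: any admissible pure lowest form `P`
(orders `m`) is `C κ`, `0` or `F_q`; in particular `∂P/∂F_{q'} = 0` for `q' ≠ q`. -/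
theorem pderiv_eq_zero_of_lowest_generator (x : GraphVars n → ℂ) {q q' : Fin n × Fin n} (hq : q' ≠ q)
    {m : ℕ} {P : MvPolynomial (Fin n × Fin n) ℂ}
    (hlow : ∀ μ ∈ (bind₁ (shift x) (generator n q)).support, m ≤ Finsupp.weight (gw n) μ)
    (hinit : weightedHomogeneousComponent (gw n) m (bind₁ (shift x) (generator n q)) =
      aeval (generator n) P) :
    pderiv q' P = 0 := by
  classical
  set κ : ℂ := x (Sum.inr q) - ∑ k : Fin n, x (Sum.inl (Sum.inl (q.1, k))) * x (Sum.inl (Sum.inr (k, q.2)))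
  have hu : bind₁ (shift x) (generator n q) = generator n q + C κ := bind₁_shift_generator_eq x q
  rw [hu] at hlow hinit
  have hg := isWeightedHomogeneous_generator (n := n) q
  have hC : IsWeightedHomogeneous (gw n) (C κ : MvPolynomial (GraphVars n) ℂ) 0 := isWeightedHomogeneous_C _ κ
  have hcomp : ∀ m', weightedHomogeneousComponent (gw n) m' (generator n q + C κ) =
      (if m' = 2 then generator n q else 0) + (if m' = 0 then C κ else 0) := fun m' => by
    rw [map_add, weightedHomogeneousComponent_of_mem hg, weightedHomogeneousComponent_of_mem hC]
  have hvan : ∀ m' < m, weightedHomogeneousComponent (gw n) m' (generator n q + C κ) = 0 :=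
    fun m' hm' => weightedHomogeneousComponent_eq_zero' m' _
      fun d hd => (lt_of_lt_of_le hm' (hlow d hd)).ne'
  rcases Nat.lt_or_ge m 3 with h3 | h3
  · interval_cases m
    · have hc : weightedHomogeneousComponent (gw n) 0 (generator n q + C κ) = C κ := by
        rw [hcomp]; simp
      rw [hc] at hinit
      have hP : P = C κ := aeval_generator_injective (by rw [← hinit, algHom_C]; rfl)
      rw [hP, pderiv_C]
    · have hc : weightedHomogeneousComponent (gw n) 1 (generator n q + C κ) = 0 := by
        rw [hcomp]; simp
      rw [hc] at hinit
      have hP : P = 0 := aeval_generator_injective (by rw [← hinit, map_zero])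
      rw [hP, map_zero]
    · have hc : weightedHomogeneousComponent (gw n) 2 (generator n q + C κ) = generator n q := by
        rw [hcomp]; simp
      rw [hc] at hinit
      have hP : P = X q := aeval_generator_injective (by rw [← hinit, aeval_X])
      rw [hP, pderiv_X, Pi.single_apply]
      simp [Ne.symm hq]
  · exfalso -- m ≥ 3 : the weight-2 component `f_q` would vanish
    have h2 := hvan 2 (by omega)
    have hc : weightedHomogeneousComponent (gw n) 2 (generator n q + C κ) = generator n q := by
      rw [hcomp]; simp
    rw [hc] at h2
    exact generator_ne_zero q h2

/-! ## The masked family for `n = 2` -/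

/-- The variable `a₀₀` of `ℂ^{12}`. -/
abbrev a00 : GraphVars 2 := Sum.inl (Sum.inl (0, 0))

/-- The MASKED TEST `t = f₁₁² − a₀₀·f₀₀`. -/
def maskedTest : MvPolynomial (GraphVars 2) ℂ :=
  generator 2 (1, 1) ^ 2 - X a00 * generator 2 (0, 0)

/-- The masked family `(f₀₀, f₀₁, f₁₀, t)`. -/
def maskedFamily : Fin 4 → MvPolynomial (GraphVars 2) ℂ :=
  ![generator 2 (0, 0), generator 2 (0, 1), generator 2 (1, 0), maskedTest]

/-- `κ_q(x) = f_q(x)`, the constant a generator acquires under the shift `θ_x`. -/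
def kap (x : GraphVars 2 → ℂ) (q : Fin 2 × Fin 2) : ℂ :=
  x (Sum.inr q) - ∑ k : Fin 2, x (Sum.inl (Sum.inl (q.1, k))) * x (Sum.inl (Sum.inr (k, q.2)))

/-- The shifted masked test, sorted by weight: `4 : f₁₁²`, `3 : −a₀₀f₀₀`,
`2 : 2κ₁₁ f₁₁ − x(a₀₀) f₀₀`, `1 : −κ₀₀ a₀₀`, `0 : κ₁₁² − x(a₀₀)κ₀₀`. -/
theorem bind₁_shift_maskedTest (x : GraphVars 2 → ℂ) :
    bind₁ (shift x) maskedTest =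
      generator 2 (1, 1) ^ 2 + C (-1) * (X a00 * generator 2 (0, 0)) +
        (C (2 * kap x (1, 1)) * generator 2 (1, 1) + C (-(x a00)) * generator 2 (0, 0)) +
        C (-(kap x (0, 0))) * X a00 + C (kap x (1, 1) ^ 2 - x a00 * kap x (0, 0)) := by
  simp only [maskedTest, kap, map_sub, map_mul, map_pow, map_neg, map_sum, map_ofNat, map_one,
    bind₁_shift_generator_eq, bind₁_X_right, shift]
  ring

/-- **UNMASKING** in one elimination step: `t + a₀₀·f₀₀ = f₁₁²` (a pure power, served by M26/M28). -/
theorem maskedTest_add_unmask : maskedTest + X a00 * generator 2 (0, 0) = generator 2 (1, 1) ^ 2 := by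
  simp [maskedTest]

/-- `f_q(x) = 0` on all four positions is `x ∈ W_2`. -/
theorem eval_generator_eq_zero_iff (x : GraphVars 2 → ℂ) :
    (∀ q : Fin 2 × Fin 2, eval x (generator 2 q) = 0) ↔ x ∈ mmGraph 2 := by
  simp only [mmGraph, Set.mem_setOf_eq, generator, map_sub, map_sum, map_mul, eval_X, sub_eq_zero]
  exact ⟨fun h i l => h (i, l), fun h q => h q.1 q.2⟩

/-- **The masked family cuts out exactly the graph** `W_2`. -/
theorem maskedFamily_vanish_iff (x : GraphVars 2 → ℂ) :
    (∀ o, eval x (maskedFamily o) = 0) ↔ x ∈ mmGraph 2 := by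
  rw [← eval_generator_eq_zero_iff]
  constructor
  · intro h
    have h0 : eval x (generator 2 (0, 0)) = 0 := h 0
    have h1 : eval x (generator 2 (0, 1)) = 0 := h 1
    have h2 : eval x (generator 2 (1, 0)) = 0 := h 2
    have h3 : eval x (generator 2 (1, 1)) = 0 := by
      have ht : eval x maskedTest = 0 := h 3
      simp only [maskedTest, map_sub, map_mul, map_pow, h0, mul_zero, sub_zero] at ht
      exact pow_eq_zero_iff (n := 2) (by norm_num) |>.1 ht
    intro q
    rcases q with ⟨i, l⟩
    fin_cases i <;> fin_cases l <;> assumption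
  · intro h o
    fin_cases o
    · exact h (0, 0)
    · exact h (0, 1)
    · exact h (1, 0)
    · simp [maskedFamily, maskedTest, h (0, 0), h (1, 1)]

/-- `a₀₀·f₀₀ ≠ 0` (value `1` at `a₀₀ = c₀₀ = 1`, rest `0`). -/
theorem X_a00_mul_generator_ne_zero : (X a00 * generator 2 (0, 0) : MvPolynomial (GraphVars 2) ℂ) ≠ 0 := by
  intro h
  have h1 : eval (fun v : GraphVars 2 => if v = a00 ∨ v = Sum.inr (0, 0) then (1 : ℂ) else 0)
      (X a00 * generator 2 (0, 0)) = 1 := by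
    simp [generator, Fin.sum_univ_two]
  rw [h, map_zero] at h1
  exact zero_ne_one h1

/-- Lowest-form analysis of the SHIFTED MASKED TEST at an arbitrary base point `x`: every admissible
pure lowest form `P` has `∂P/∂F₁₁ = 0`. -/
theorem pderiv_eq_zero_of_lowest_maskedTest (x : GraphVars 2 → ℂ) {m : ℕ}
    {P : MvPolynomial (Fin 2 × Fin 2) ℂ}
    (hlow : ∀ μ ∈ (bind₁ (shift x) maskedTest).support, m ≤ Finsupp.weight (gw 2) μ)
    (hinit : weightedHomogeneousComponent (gw 2) m (bind₁ (shift x) maskedTest) =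
      aeval (generator 2) P) :
    pderiv (1, 1) P = 0 := by
  classical
  have hvan : ∀ m' < m, weightedHomogeneousComponent (gw 2) m' (bind₁ (shift x) maskedTest) = 0 :=
    fun m' hm' => weightedHomogeneousComponent_eq_zero' m' _
      fun d hd => (lt_of_lt_of_le hm' (hlow d hd)).ne'
  have hu := bind₁_shift_maskedTest x
  have hg0 : IsWeightedHomogeneous (gw 2) (generator 2 (0, 0)) 2 := isWeightedHomogeneous_generator _
  have hg1 : IsWeightedHomogeneous (gw 2) (generator 2 (1, 1)) 2 := isWeightedHomogeneous_generator _
  have ha1 : IsWeightedHomogeneous (gw 2) (X a00 : MvPolynomial (GraphVars 2) ℂ) 1 := by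
    simpa [gw] using isWeightedHomogeneous_X ℂ (gw 2) a00
  have hA4 : IsWeightedHomogeneous (gw 2) (generator 2 (1, 1) ^ 2) 4 :=
    fun d hd => (hg1.pow 2 hd).trans (by norm_num)
  have hA3 : IsWeightedHomogeneous (gw 2)
      (C (-1) * (X a00 * generator 2 (0, 0)) : MvPolynomial (GraphVars 2) ℂ) 3 :=
    fun d hd => (((isWeightedHomogeneous_C (gw 2) (-1 : ℂ)).mul (ha1.mul hg0)) hd).trans (by norm_num)
  have hA2 : IsWeightedHomogeneous (gw 2)
      (C (2 * kap x (1, 1)) * generator 2 (1, 1) + C (-(x a00)) * generator 2 (0, 0)) 2 :=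
    fun d hd => ((((isWeightedHomogeneous_C (gw 2) (2 * kap x (1, 1))).mul hg1).add
      ((isWeightedHomogeneous_C (gw 2) (-(x a00))).mul hg0)) hd).trans (by norm_num)
  have hA1 : IsWeightedHomogeneous (gw 2) (C (-(kap x (0, 0))) * X a00 : MvPolynomial (GraphVars 2) ℂ) 1 :=
    fun d hd => (((isWeightedHomogeneous_C (gw 2) (-(kap x (0, 0)))).mul ha1) hd).trans (by norm_num)
  have hA0 : IsWeightedHomogeneous (gw 2)
      (C (kap x (1, 1) ^ 2 - x a00 * kap x (0, 0)) : MvPolynomial (GraphVars 2) ℂ) 0 :=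
    isWeightedHomogeneous_C _ _
  have hA3ne : (C (-1) * (X a00 * generator 2 (0, 0)) : MvPolynomial (GraphVars 2) ℂ) ≠ 0 := by
    rw [map_neg, map_one, neg_one_mul, Ne, neg_eq_zero]
    exact X_a00_mul_generator_ne_zero
  generalize hB4 : (generator 2 (1, 1) ^ 2 : MvPolynomial (GraphVars 2) ℂ) = A4 at hu hA4
  generalize hB3 : (C (-1) * (X a00 * generator 2 (0, 0)) : MvPolynomial (GraphVars 2) ℂ) = A3
    at hu hA3 hA3ne
  generalize hB2 : (C (2 * kap x (1, 1)) * generator 2 (1, 1) + C (-(x a00)) * generator 2 (0, 0) :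
    MvPolynomial (GraphVars 2) ℂ) = A2 at hu hA2
  generalize hB1 : (C (-(kap x (0, 0))) * X a00 : MvPolynomial (GraphVars 2) ℂ) = A1 at hu hA1
  generalize hB0 : (C (kap x (1, 1) ^ 2 - x a00 * kap x (0, 0)) : MvPolynomial (GraphVars 2) ℂ) = A0
    at hu hA0
  have hcomp : ∀ m', weightedHomogeneousComponent (gw 2) m' (bind₁ (shift x) maskedTest) =
      (if m' = 4 then A4 else 0) + (if m' = 3 then A3 else 0) + (if m' = 2 then A2 else 0) +
        (if m' = 1 then A1 else 0) + (if m' = 0 then A0 else 0) := fun m' => by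
    rw [hu]
    simp only [map_add, weightedHomogeneousComponent_of_mem hA4, weightedHomogeneousComponent_of_mem hA3,
      weightedHomogeneousComponent_of_mem hA2, weightedHomogeneousComponent_of_mem hA1,
      weightedHomogeneousComponent_of_mem hA0]
  have hc0 : weightedHomogeneousComponent (gw 2) 0 (bind₁ (shift x) maskedTest) = A0 := by
    rw [hcomp]; simp
  have hc1 : weightedHomogeneousComponent (gw 2) 1 (bind₁ (shift x) maskedTest) = A1 := by
    rw [hcomp]; simp
  have hc2 : weightedHomogeneousComponent (gw 2) 2 (bind₁ (shift x) maskedTest) = A2 := by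
    rw [hcomp]; simp
  have hc3 : weightedHomogeneousComponent (gw 2) 3 (bind₁ (shift x) maskedTest) = A3 := by
    rw [hcomp]; simp
  rcases Nat.lt_or_ge m 4 with h4 | h4
  · interval_cases m
    · rw [hc0] at hinit
      have hP : P = C (kap x (1, 1) ^ 2 - x a00 * kap x (0, 0)) :=
        aeval_generator_injective (by rw [← hinit, algHom_C, ← hB0]; rfl)
      rw [hP, pderiv_C]
    · rw [hc1] at hinit -- odd weight ⇒ P = 0
      have hz : A1 = 0 := eq_zero_of_isWeightedHomogeneous_odd_eq_aeval (d := 0) hA1 hinit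
      have hP : P = 0 := aeval_generator_injective (by rw [← hinit, hz, map_zero])
      rw [hP, map_zero]
    · -- m = 2 : A1 = A0 = 0 force κ₀₀ = κ₁₁ = 0, so P = -x(a₀₀) F₀₀
      rw [hc2] at hinit
      have h1 := hvan 1 (by norm_num)
      have h0 := hvan 0 (by norm_num)
      rw [hc1, ← hB1] at h1
      rw [hc0, ← hB0, C_eq_zero] at h0
      have hk0 : kap x (0, 0) = 0 := by
        rcases mul_eq_zero.1 h1 with h | h
        · simpa using h
        · exact absurd h (X_ne_zero _)
      have hk1 : kap x (1, 1) = 0 := by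
        rw [hk0, mul_zero, sub_zero] at h0
        exact pow_eq_zero_iff (n := 2) (by norm_num) |>.1 h0
      have hA2l : A2 = C (-(x a00)) * generator 2 (0, 0) := by
        rw [← hB2, hk1, mul_zero, C_0, zero_mul, zero_add]
      have hA2' : A2 = aeval (generator 2) (C (-(x a00)) * X (0, 0)) := by
        rw [hA2l, map_mul, aeval_C, aeval_X, MvPolynomial.algebraMap_eq]
      have hP : P = C (-(x a00)) * X (0, 0) := aeval_generator_injective (by rw [← hinit, hA2'])
      rw [hP]
      simp [pderiv_X]
    · rw [hc3] at hinit -- odd weight ⇒ A3 = 0, contradiction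
      exact absurd (eq_zero_of_isWeightedHomogeneous_odd_eq_aeval (d := 1) hA3 hinit) hA3ne
  · have h3 := hvan 3 (by omega) -- m ≥ 4 : the weight-3 component would vanish
    rw [hc3] at h3
    exact absurd h3 hA3ne

/-- **MASKING**: at EVERY base point, every admissible choice of orders and pure lowest forms for
the masked family has `∂P_o/∂F₁₁ = 0` for all `o`. -/
theorem maskedFamily_pderiv_eq_zero (x : GraphVars 2 → ℂ) (m : Fin 4 → ℕ)
    (P : Fin 4 → MvPolynomial (Fin 2 × Fin 2) ℂ)
    (hlow : ∀ o, ∀ μ ∈ (bind₁ (shift x) (maskedFamily o)).support, m o ≤ Finsupp.weight (gw 2) μ)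
    (hinit : ∀ o, weightedHomogeneousComponent (gw 2) (m o) (bind₁ (shift x) (maskedFamily o)) =
      aeval (generator 2) (P o)) :
    ∀ o, pderiv (1, 1) (P o) = 0 := by
  intro o
  fin_cases o
  · exact pderiv_eq_zero_of_lowest_generator x (q := (0, 0)) (by decide) (hlow 0) (hinit 0)
  · exact pderiv_eq_zero_of_lowest_generator x (q := (0, 1)) (by decide) (hlow 1) (hinit 1)
  · exact pderiv_eq_zero_of_lowest_generator x (q := (1, 0)) (by decide) (hlow 2) (hinit 2)
  · exact pderiv_eq_zero_of_lowest_maskedTest x (hlow 3) (hinit 3)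

/-- A matrix over `Fin 2 × Fin 2` columns with a zero column has rank `≤ 3`. -/
theorem rank_le_three_of_column_zero {T : ℕ} (M : Matrix (Fin T) (Fin 2 × Fin 2) ℂ) (q₀ : Fin 2 × Fin 2)
    (h : ∀ o, M o q₀ = 0) : M.rank ≤ 3 := by
  classical
  let N : Matrix (Fin T) {q : Fin 2 × Fin 2 // ¬ q = q₀} ℂ := Matrix.of fun o q => M o q.1
  let Q : Matrix {q : Fin 2 × Fin 2 // ¬ q = q₀} (Fin 2 × Fin 2) ℂ :=
    Matrix.of fun q' q => if q'.1 = q then 1 else 0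
  have hM : M = N * Q := by
    ext o q
    rw [Matrix.mul_apply]
    by_cases hq : q = q₀
    · subst hq
      rw [h o]
      symm
      refine Finset.sum_eq_zero fun q' _ => ?_
      simp [N, Q, q'.2]
    · rw [Finset.sum_eq_single ⟨q, hq⟩]
      · simp [N, Q]
      · intro q' _ hne
        have : q'.1 ≠ q := fun e => hne (Subtype.ext e)
        simp [N, Q, this]
      · intro hq'; exact absurd (Finset.mem_univ _) hq'
  have hcard : Fintype.card {q : Fin 2 × Fin 2 // ¬ q = q₀} = 3 := by
    rw [Fintype.card_subtype_compl, Fintype.card_subtype_eq]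
    simp
  calc M.rank = (N * Q).rank := by rw [hM]
    _ ≤ N.rank := Matrix.rank_mul_le_left N Q
    _ ≤ Fintype.card {q : Fin 2 × Fin 2 // ¬ q = q₀} := Matrix.rank_le_card_width N
    _ = 3 := hcard

/-- **The masked family is lowest-form DEGENERATE at every base point**: the gradient matrix of any
admissible pure lowest forms has rank `≤ 3 < 4 = n²`. -/
theorem maskedFamily_gradMatrix_rank_le (x : GraphVars 2 → ℂ) (m : Fin 4 → ℕ)
    (P : Fin 4 → MvPolynomial (Fin 2 × Fin 2) ℂ)
    (hlow : ∀ o, ∀ μ ∈ (bind₁ (shift x) (maskedFamily o)).support, m o ≤ Finsupp.weight (gw 2) μ)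
    (hinit : ∀ o, weightedHomogeneousComponent (gw 2) (m o) (bind₁ (shift x) (maskedFamily o)) =
      aeval (generator 2) (P o)) (γ : Fin 2 × Fin 2 → ℂ) :
    (gradMatrix γ P).rank ≤ 3 := by
  refine rank_le_three_of_column_zero _ (1, 1) fun o => ?_
  simp only [gradMatrix, Matrix.of_apply, maskedFamily_pderiv_eq_zero x m P hlow hinit o, map_zero]

/-! ## System level -/

namespace EqSystem

/-- Any system whose tests are the masked family cuts out the graph (so it is correct as soon as its
circuit is fan-in two). -/
theorem zeroSet_eq_of_tests_eq_maskedFamily {E : EqSystem 2} (hlen : E.tests.length = 4)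
    (hE : ∀ o : Fin E.tests.length, E.testPoly (E.tests.get o) = maskedFamily (Fin.cast hlen o)) :
    E.zeroSet = mmGraph 2 := by
  ext x
  rw [← maskedFamily_vanish_iff]
  simp only [zeroSet, Set.mem_setOf_eq]
  constructor
  · intro h o
    have := h (E.tests.get (Fin.cast hlen.symm o)) (List.get_mem _ _)
    rw [hE] at this
    simpa using this
  · intro h j hj
    obtain ⟨o, rfl⟩ := List.get_of_mem hj
    rw [hE]
    exact h _

/-- **No system with the masked tests is lowest-form nondegenerate, at any base point.** -/
theorem not_lowInitNondegAt_of_tests_eq_maskedFamily {E : EqSystem 2} (hlen : E.tests.length = 4)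
    (hE : ∀ o : Fin E.tests.length, E.testPoly (E.tests.get o) = maskedFamily (Fin.cast hlen o))
    (x : GraphVars 2 → ℂ) : ¬ E.LowInitNondegAt x := by
  rintro ⟨m, P, γ, hlow, hinit, hrank⟩
  let c : Fin 4 ≃ Fin E.tests.length := finCongr hlen.symm
  have hlow' : ∀ o, ∀ μ ∈ (bind₁ (shift x) (maskedFamily o)).support, m (c o) ≤ Finsupp.weight (gw 2) μ := by
    intro o μ hμ
    refine hlow (c o) μ ?_
    rw [hE]; simpa [c] using hμ
  have hinit' : ∀ o, weightedHomogeneousComponent (gw 2) (m (c o)) (bind₁ (shift x) (maskedFamily o)) =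
      aeval (generator 2) (P (c o)) := by
    intro o
    rw [← hinit (c o), hE]; simp [c]
  have hle := maskedFamily_gradMatrix_rank_le x (fun o => m (c o)) (fun o => P (c o)) hlow' hinit' γ
  have hG : (gradMatrix γ fun o => P (c o)) = (gradMatrix γ P).submatrix c (Equiv.refl _) := by
    ext o q; rfl
  rw [hG, Matrix.rank_submatrix, hrank] at hle
  omega

/-- … hence not lowest-form nondegenerate anywhere. -/
theorem not_lowInitNondeg_of_tests_eq_maskedFamily {E : EqSystem 2} (hlen : E.tests.length = 4)
    (hE : ∀ o : Fin E.tests.length, E.testPoly (E.tests.get o) = maskedFamily (Fin.cast hlen o)) :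
    ¬ E.LowInitNondeg := by
  rintro ⟨x, hx⟩
  exact not_lowInitNondegAt_of_tests_eq_maskedFamily hlen hE x hx

end EqSystem

end Summit.MatrixMultiplication.MatrixMultiplication.Theorems.GraphEquations
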